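import Summits.QuantumFields.YangMills.Theorems.UnitScaleGibbsRegionalPlaquetteExpMoment
import Summits.QuantumFields.YangMills.Theorems.UnitScaleGibbsBoxPeierlsPolynomial
import HarnessLib

/-!
# LINE 30 «CurvaturePoincare» — stub (LM) `stub_localBoxExpMoment` PROVED: the LOCAL exponential moment and mean of the box action at
# coupling `β_K/24`, uniformly in `γ ≤ 1`, `K`, the volume and the box (cell `ym3-torus`, rung R3 = YM₃ on T³ — NOT Clay)

Width seat `ym-ust-19936-w3` g17.  STUB MODE `--supports stmt-QuantumFields-23532` (`PoincareLipschitz.MesoscopicConcentrationL`, K1′): the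
theorem `stub_localBoxExpMoment` below is the registered stub of the skeleton `Cruxes/HistoryTailL/Lines/curvature_poincare.lean` (ideator
`ym-r3-idea-2` g16, registered 2026-08-29T19:26Z) TOKEN FOR TOKEN.  THEOREMS ONLY (no `def`).

THE ARGUMENT.  The engine is this seat's REGIONAL BARE STIFFNESS ✓`UnitScaleGibbsRegionalPlaquetteExpMoment.exists_regional_expMoment_le`
(`∫ exp(c·β_K·Σ_{a∈Q} dist₁(U(∂a))²) dGibbs_K ≤ e^{E·#Q}` for EVERY finite plaquette set `Q` and every `0 ≤ c ≤ 1/16` — cube chessboard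
✓`N20LCSRestrictedChessboard.chessboard_exp_cubeEnergy` + the exact torus free energy ✓`CoarseStiffnessTailUniformMeanAction.log_partitionFn_ratio_le_exact`),
read at `c = 1/24` on the box `Q = boxPlaqs(x₀, x₀ + n − 1)` whose cardinality is `≤ 3(n+1)³ ≤ 24n³` (✓`UnitScaleGibbsBoxPeierlsPolynomial.card_filter_mem_boxPlaqs_le`);
the mean by Jensen (✓`CoarseStiffnessTailPressureConvexity.integral_le_log_integral_exp`: `(β_K/24)∫Σ ≤ log∫e^{(β_K/24)Σ} ≤ 24E·n³`).  Constants: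
`E₁ = 576·E`, `γ₁ = 1`.  §1 also records the two Chebyshev corollaries of the regional moment for arbitrary regions: the regional energy tail and
the β-UNIFORM JOINT PEIERLS bound at every threshold (✓`…LBareUniformCount.jointPeierls_bare` without its `(√β_K)^9` per member).

HONEST SCOPE.  Level-0 measure theory over landed theorems; it proves NOTHING of (NP) `stub_curvaturePinning`, of the residual
`stub_moderateDeviationResidual`, of K1 (23532), `HistoryTailL` (19936) or of rung R3 (`YM3TorusSU2` — a RECORD rung: not d = 4, not infinite volume,
not a mass gap, not Clay); the Yang–Mills mass gap is NOT touched.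

References: J. Fröhlich, R. Israel, E. H. Lieb, B. Simon, CMP **62** (1978) 1–34 [FrohlichIsraelLiebSimon1978] (Thm 4.1);
T. Bałaban, CMP **102** (1985) 255–275 [Balaban1985UV3] ((7) p.257, (11) p.258); M. Ledoux, The Concentration of Measure Phenomenon (2001) §1.1.
-/

set_option autoImplicit false

noncomputable section

namespace Summit.QuantumFields.YangMills.Theorems.CurvaturePoincareStubLocalBoxExpMoment

open MeasureTheory ProbabilityTheory Finset
open Literature.MathematicalPhysics.QuantumFieldTheory
open Literature.MathematicalPhysics.QuantumFieldTheory.Balaban1983to89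
open Literature.MathematicalPhysics.QuantumFieldTheory.Balaban1983to89.T3ContinuumYM3Torus
open Literature.MathematicalPhysics.QuantumFieldTheory.Balaban1983to89.T3UnitScaleTilt
open Literature.MathematicalPhysics.QuantumFieldTheory.Balaban1983to89.T3UnitLawDensityEML (ℰp)
open Literature.MathematicalPhysics.QuantumFieldTheory.Balaban1983to89.T4AxialGaugeSmallField (boxPlaqs castSite axialGauge)
open Literature.MathematicalPhysics.QuantumFieldTheory.Balaban1983to89.T4PairDerivBridge (dist1_le_two_specialUnitaryGroup)
open Summit.QuantumFields.YangMills.Theorems.CoarseStiffnessTailPressureConvexity (integral_le_log_integral_exp measurable_dist1_plaqHol)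
open Summit.QuantumFields.YangMills.Theorems.UnitScaleGibbsRegionalPlaquetteExpMoment (exists_regional_expMoment_le)
open Summit.QuantumFields.YangMills.Theorems.UnitScaleGibbsBoxPeierlsPolynomial (card_filter_mem_boxPlaqs_le)

/-! ## §1 Rows for an arbitrary region: measurability, range, tails -/

section Region

variable (F : T3Family)

/-- The regional square sum is measurable. [folklore] -/
theorem measurable_sqSum_region (K : ℕ) (Q : Finset (Plaq (F.P K) 0)) :
    Measurable fun U : GaugeField (F.P K) 0 (Matrix.specialUnitaryGroup (Fin 2) ℂ) =>
      ∑ a ∈ Q, dist1 (GaugeField.plaqHol U a) ^ 2 :=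
  Finset.measurable_sum _ fun a _ => (measurable_dist1_plaqHol F K a).pow_const 2

/-- The regional square sum lies in `[0, 4·#Q]` (`|W − 1| ≤ 2` on `SU(2)`). [folklore] -/
theorem sqSum_region_mem {K : ℕ} (U : GaugeField (F.P K) 0 (Matrix.specialUnitaryGroup (Fin 2) ℂ)) (Q : Finset (Plaq (F.P K) 0)) :
    0 ≤ ∑ a ∈ Q, dist1 (GaugeField.plaqHol U a) ^ 2 ∧ ∑ a ∈ Q, dist1 (GaugeField.plaqHol U a) ^ 2 ≤ 4 * (Q.card : ℝ) := by
  refine ⟨Finset.sum_nonneg fun a _ => sq_nonneg _, ?_⟩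
  calc ∑ a ∈ Q, dist1 (GaugeField.plaqHol U a) ^ 2 ≤ ∑ _a ∈ Q, (4 : ℝ) := Finset.sum_le_sum fun a _ => by
        have h2 := dist1_le_two_specialUnitaryGroup (GaugeField.plaqHol U a)
        have h0 := GaugeGroup.dist1_nonneg (GaugeField.plaqHol U a)
        nlinarith
    _ = 4 * (Q.card : ℝ) := by rw [Finset.sum_const, nsmul_eq_mul, mul_comm]

/-- On the joint event `{∀ a ∈ Q, s ≤ dist₁(U(∂a))}` (`0 ≤ s`) the regional square sum is at least `#Q·s²`. [folklore] -/
theorem card_mul_sq_le_sqSum_region (K : ℕ) {s : ℝ} (hs : 0 ≤ s) (Q : Finset (Plaq (F.P K) 0))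
    (U : GaugeField (F.P K) 0 (Matrix.specialUnitaryGroup (Fin 2) ℂ))
    (hU : ∀ a ∈ Q, s ≤ dist1 (GaugeField.plaqHol U a)) :
    (Q.card : ℝ) * s ^ 2 ≤ ∑ a ∈ Q, dist1 (GaugeField.plaqHol U a) ^ 2 := by
  calc (Q.card : ℝ) * s ^ 2 = ∑ _a ∈ Q, s ^ 2 := by rw [Finset.sum_const, nsmul_eq_mul]
    _ ≤ ∑ a ∈ Q, dist1 (GaugeField.plaqHol U a) ^ 2 := Finset.sum_le_sum fun a ha => pow_le_pow_left₀ hs (hU a ha) 2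

/-- ★★ **THE REGIONAL ENERGY TAIL**: with the `E ≥ 0`, `c > 0` of `exists_regional_expMoment_le`, for every `F`, `0 < γ ≤ 1`, `K`, every finite
plaquette set `Q` and every `u`: `Gibbs_K{u ≤ Σ_{a∈Q} dist₁(U(∂a))²} ≤ exp(E·#Q)·exp(−c·β_K·u)` (exponential Chebyshev).
[cite: FrohlichIsraelLiebSimon1978, Thm 4.1; Balaban1985UV3, (11) p.258] -/
theorem gibbsK_real_sqSum_region_ge_le :
    ∃ E c : ℝ, 0 ≤ E ∧ 0 < c ∧ ∀ (F : T3Family) (γ : ℝ), 0 < γ → γ ≤ 1 → ∀ (K : ℕ) (Q : Finset (Plaq (F.P K) 0)) (u : ℝ),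
      (gibbsK F ℰp γ K).real {U | u ≤ ∑ a ∈ Q, dist1 (GaugeField.plaqHol U a) ^ 2} ≤
        Real.exp (E * Q.card) * Real.exp (-(c * (F.scheme ℰp γ).β K * u)) := by
  obtain ⟨E, hE0, hE⟩ := exists_regional_expMoment_le
  refine ⟨E, 1 / 16, hE0, by norm_num, fun F γ hγ hγ1 K Q u => ?_⟩
  set c : ℝ := 1 / 16 with hcdef
  haveI := isProbabilityMeasure_gibbsK F ℰp hγ.le K
  set β : ℝ := (γ * ((F.L : ℝ)⁻¹) ^ K)⁻¹ with hβdef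
  have hβeq : (F.scheme ℰp γ).β K = β := rfl
  have hβ0 : 0 < β := by
    rw [hβdef]
    have hL0 : (0 : ℝ) < F.L := by exact_mod_cast (zero_lt_one.trans F.hL.2)
    exact inv_pos.mpr (mul_pos hγ (pow_pos (inv_pos.mpr hL0) _))
  set X : GaugeField (F.P K) 0 (Matrix.specialUnitaryGroup (Fin 2) ℂ) → ℝ := fun U =>
    ∑ a ∈ Q, dist1 (GaugeField.plaqHol U a) ^ 2 with hXdef
  set t : ℝ := c * β with htdef
  have ht0 : 0 ≤ t := by positivity
  have hint : Integrable (fun U => Real.exp (t * X U)) (gibbsK F ℰp γ K) := by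
    have hmeas : Measurable fun U => Real.exp (t * X U) :=
      Real.measurable_exp.comp ((measurable_sqSum_region F K Q).const_mul t)
    refine (integrable_const (Real.exp (t * (4 * (Q.card : ℝ))))).mono' hmeas.aestronglyMeasurable (ae_of_all _ fun U => ?_)
    rw [Real.norm_eq_abs, abs_of_pos (Real.exp_pos _)]
    exact Real.exp_le_exp.mpr (mul_le_mul_of_nonneg_left (sqSum_region_mem F U Q).2 ht0)
  have hmgf : mgf X (gibbsK F ℰp γ K) t ≤ Real.exp (E * Q.card) := by
    simp only [mgf]
    have h := hE F γ hγ hγ1 K Q c (by norm_num) le_rfl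
    convert h using 4
  calc (gibbsK F ℰp γ K).real {U | u ≤ X U}
      ≤ Real.exp (-t * u) * mgf X (gibbsK F ℰp γ K) t := measure_ge_le_exp_mul_mgf u ht0 hint
    _ ≤ Real.exp (-t * u) * Real.exp (E * Q.card) := mul_le_mul_of_nonneg_left hmgf (Real.exp_pos _).le
    _ = Real.exp (E * Q.card) * Real.exp (-(c * (F.scheme ℰp γ).β K * u)) := by
        rw [hβeq, htdef, mul_comm (Real.exp (-(c * β) * u))]
        congr 2
        ring

/-- ★★ **THE β-UNIFORM JOINT PEIERLS BOUND AT EVERY THRESHOLD**: with the same absolute `E ≥ 0`, `c > 0`, for every `F`, `0 < γ ≤ 1`, `K`,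
every finite plaquette set `Q` and every `s ≥ 0`:
`Gibbs_K{∀ a ∈ Q, s ≤ dist₁(U(∂a))} ≤ exp(E·#Q)·exp(−c·β_K·#Q·s²) = (e^{E}·e^{−c·β_K·s²})^{#Q}` — the joint chessboard tail with NO `(√β_K)^9`
per member (compare ✓`…LBareUniformCount.jointPeierls_bare`). [cite: FrohlichIsraelLiebSimon1978, Thm 4.1; Balaban1985UV3, (11) p.258] -/
theorem gibbsK_real_forall_dist1_ge_le_uniform :
    ∃ E c : ℝ, 0 ≤ E ∧ 0 < c ∧ ∀ (F : T3Family) (γ : ℝ), 0 < γ → γ ≤ 1 → ∀ (K : ℕ) (Q : Finset (Plaq (F.P K) 0)) (s : ℝ), 0 ≤ s →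
      (gibbsK F ℰp γ K).real {U | ∀ a ∈ Q, s ≤ dist1 (GaugeField.plaqHol U a)} ≤
        Real.exp (E * Q.card) * Real.exp (-(c * (F.scheme ℰp γ).β K * (Q.card * s ^ 2))) := by
  obtain ⟨E, c, hE0, hc, hE⟩ := gibbsK_real_sqSum_region_ge_le
  refine ⟨E, c, hE0, hc, fun F γ hγ hγ1 K Q s hs => ?_⟩
  haveI := isProbabilityMeasure_gibbsK F ℰp hγ.le K
  have hsub : {U : GaugeField (F.P K) 0 (Matrix.specialUnitaryGroup (Fin 2) ℂ) | ∀ a ∈ Q, s ≤ dist1 (GaugeField.plaqHol U a)} ⊆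
      {U | (Q.card : ℝ) * s ^ 2 ≤ ∑ a ∈ Q, dist1 (GaugeField.plaqHol U a) ^ 2} := fun U hU =>
    card_mul_sq_le_sqSum_region F K hs Q U hU
  exact (measureReal_mono hsub).trans (hE F γ hγ hγ1 K Q _)


/-- ★ **THE FOUR ROWS OF (LM) FOR AN ARBITRARY REGION OF CARDINALITY `≤ 3(n+1)³`**: measurability, range `[0, 12(n+1)³]`, the exponential moment
at `β_K/24` bounded by `e^{576E·n³}` and the mean bounded by `576E·n³/β_K` (regional bare stiffness at `c = 1/24`; Jensen for the mean;
`#Q ≤ 3(n+1)³ ≤ 24n³` for `n ≥ 1`). [cite: FrohlichIsraelLiebSimon1978, Thm 4.1] -/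
theorem localBox_rows_of_card_le {E : ℝ} (hE0 : 0 ≤ E)
    (hE : ∀ (F : T3Family) (γ : ℝ), 0 < γ → γ ≤ 1 → ∀ (K : ℕ) (Q : Finset (Plaq (F.P K) 0)) (c : ℝ), 0 ≤ c → c ≤ 1 / 16 →
      ∫ U, Real.exp (c * (γ * ((F.L : ℝ)⁻¹) ^ K)⁻¹ * ∑ a ∈ Q, dist1 (GaugeField.plaqHol U a) ^ 2) ∂(gibbsK F ℰp γ K) ≤
        Real.exp (E * Q.card))
    {γ : ℝ} (hγ : 0 < γ) (hγ1 : γ ≤ 1) (K n : ℕ) (hn : 1 ≤ n) (Q : Finset (Plaq (F.P K) 0))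
    (hQ : (Q.card : ℝ) ≤ 3 * ((n : ℝ) + 1) ^ 3) :
    (Measurable fun U : GaugeField (F.P K) 0 (Matrix.specialUnitaryGroup (Fin 2) ℂ) =>
      (∑ p ∈ Q, GaugeGroup.dist1 (GaugeField.plaqHol U p) ^ 2)) ∧
    (∀ U : GaugeField (F.P K) 0 (Matrix.specialUnitaryGroup (Fin 2) ℂ),
      0 ≤ (∑ p ∈ Q, GaugeGroup.dist1 (GaugeField.plaqHol U p) ^ 2) ∧
        (∑ p ∈ Q, GaugeGroup.dist1 (GaugeField.plaqHol U p) ^ 2) ≤ 12 * ((n : ℝ) + 1) ^ 3) ∧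
    ∫ U, Real.exp ((F.scheme ℰp γ).β K / 24 * (∑ p ∈ Q, GaugeGroup.dist1 (GaugeField.plaqHol U p) ^ 2)) ∂(gibbsK F ℰp γ K) ≤
      Real.exp (576 * E * (n : ℝ) ^ 3) ∧
    ∫ U, (∑ p ∈ Q, GaugeGroup.dist1 (GaugeField.plaqHol U p) ^ 2) ∂(gibbsK F ℰp γ K) ≤ 576 * E * (n : ℝ) ^ 3 / (F.scheme ℰp γ).β K := by
  haveI := isProbabilityMeasure_gibbsK F ℰp hγ.le K
  set β : ℝ := (γ * ((F.L : ℝ)⁻¹) ^ K)⁻¹ with hβdef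
  have hβeq : (F.scheme ℰp γ).β K = β := rfl
  have hβ0 : 0 < β := by
    rw [hβdef]
    have hL0 : (0 : ℝ) < F.L := by exact_mod_cast (zero_lt_one.trans F.hL.2)
    exact inv_pos.mpr (mul_pos hγ (pow_pos (inv_pos.mpr hL0) _))
  have hn1 : (1 : ℝ) ≤ n := by exact_mod_cast hn
  have hcube : ((n : ℝ) + 1) ^ 3 ≤ 8 * (n : ℝ) ^ 3 := by
    have h2 : (n : ℝ) + 1 ≤ 2 * n := by linarith
    calc ((n : ℝ) + 1) ^ 3 ≤ (2 * (n : ℝ)) ^ 3 := pow_le_pow_left₀ (by positivity) h2 3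
      _ = 8 * (n : ℝ) ^ 3 := by ring
  have hcard : (Q.card : ℝ) ≤ 24 * (n : ℝ) ^ 3 := hQ.trans (by nlinarith)
  have hEQ : E * (Q.card : ℝ) ≤ 24 * E * (n : ℝ) ^ 3 := by nlinarith
  have hE576 : 24 * E * (n : ℝ) ^ 3 ≤ 576 * E * (n : ℝ) ^ 3 := by nlinarith [pow_nonneg (Nat.cast_nonneg n : (0 : ℝ) ≤ n) 3]
  -- the range row
  have hrange := sqSum_region_mem F (K := K)
  -- the moment row at `c = 1/24`
  have h24 : ∫ U, Real.exp ((F.scheme ℰp γ).β K / 24 * (∑ p ∈ Q, GaugeGroup.dist1 (GaugeField.plaqHol U p) ^ 2)) ∂(gibbsK F ℰp γ K) ≤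
      Real.exp (E * Q.card) := by
    have h := hE F γ hγ hγ1 K Q (1 / 24) (by norm_num) (by norm_num)
    have h' : ∫ U, Real.exp ((F.scheme ℰp γ).β K / 24 * (∑ p ∈ Q, GaugeGroup.dist1 (GaugeField.plaqHol U p) ^ 2)) ∂(gibbsK F ℰp γ K) =
        ∫ U, Real.exp (1 / 24 * (γ * ((F.L : ℝ)⁻¹) ^ K)⁻¹ * ∑ a ∈ Q, dist1 (GaugeField.plaqHol U a) ^ 2) ∂(gibbsK F ℰp γ K) := by
      refine integral_congr_ae (ae_of_all _ fun U => ?_)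
      rw [hβeq, hβdef]
      ring_nf
    rw [h']
    exact h
  have hmom : ∫ U, Real.exp ((F.scheme ℰp γ).β K / 24 * (∑ p ∈ Q, GaugeGroup.dist1 (GaugeField.plaqHol U p) ^ 2)) ∂(gibbsK F ℰp γ K) ≤
      Real.exp (576 * E * (n : ℝ) ^ 3) :=
    h24.trans (Real.exp_le_exp.mpr (hEQ.trans hE576))
  refine ⟨measurable_sqSum_region F K Q, fun U => ⟨(hrange U Q).1, (hrange U Q).2.trans (by nlinarith)⟩, hmom, ?_⟩
  -- the mean row by Jensen
  have hXm : Measurable fun U : GaugeField (F.P K) 0 (Matrix.specialUnitaryGroup (Fin 2) ℂ) =>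
      (F.scheme ℰp γ).β K / 24 * (∑ p ∈ Q, GaugeGroup.dist1 (GaugeField.plaqHol U p) ^ 2) :=
    (measurable_sqSum_region F K Q).const_mul _
  have hXb : ∀ U : GaugeField (F.P K) 0 (Matrix.specialUnitaryGroup (Fin 2) ℂ),
      |(F.scheme ℰp γ).β K / 24 * (∑ p ∈ Q, GaugeGroup.dist1 (GaugeField.plaqHol U p) ^ 2)| ≤ β / 24 * (4 * (Q.card : ℝ)) := fun U => by
    rw [hβeq, abs_of_nonneg (mul_nonneg (by positivity) (hrange U Q).1)]
    exact mul_le_mul_of_nonneg_left (hrange U Q).2 (by positivity)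
  have hJ := integral_le_log_integral_exp (μ := gibbsK F ℰp γ K) hXm hXb
  have hlog : Real.log (∫ U, Real.exp ((F.scheme ℰp γ).β K / 24 * (∑ p ∈ Q, GaugeGroup.dist1 (GaugeField.plaqHol U p) ^ 2))
      ∂(gibbsK F ℰp γ K)) ≤ 24 * E * (n : ℝ) ^ 3 := by
    have hpos : 0 < ∫ U, Real.exp ((F.scheme ℰp γ).β K / 24 * (∑ p ∈ Q, GaugeGroup.dist1 (GaugeField.plaqHol U p) ^ 2))
        ∂(gibbsK F ℰp γ K) := by
      have hint : Integrable (fun U : GaugeField (F.P K) 0 (Matrix.specialUnitaryGroup (Fin 2) ℂ) =>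
          Real.exp ((F.scheme ℰp γ).β K / 24 * (∑ p ∈ Q, GaugeGroup.dist1 (GaugeField.plaqHol U p) ^ 2))) (gibbsK F ℰp γ K) := by
        refine (integrable_const (Real.exp (β / 24 * (4 * (Q.card : ℝ))))).mono' hXm.exp.aestronglyMeasurable
          (ae_of_all _ fun U => ?_)
        rw [Real.norm_eq_abs, abs_of_pos (Real.exp_pos _)]
        exact Real.exp_le_exp.mpr ((le_abs_self _).trans (hXb U))
      have h1 : (1 : ℝ) ≤ ∫ U, Real.exp ((F.scheme ℰp γ).β K / 24 * (∑ p ∈ Q, GaugeGroup.dist1 (GaugeField.plaqHol U p) ^ 2))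
          ∂(gibbsK F ℰp γ K) := by
        calc (1 : ℝ) = ∫ _U, (1 : ℝ) ∂(gibbsK F ℰp γ K) := by simp
          _ ≤ _ := integral_mono (integrable_const _) hint fun U =>
                Real.one_le_exp (mul_nonneg (by rw [hβeq]; positivity) (hrange U Q).1)
      linarith
    rw [Real.log_le_iff_le_exp hpos]
    exact h24.trans (Real.exp_le_exp.mpr hEQ)
  have hmean : (F.scheme ℰp γ).β K / 24 * ∫ U, (∑ p ∈ Q, GaugeGroup.dist1 (GaugeField.plaqHol U p) ^ 2) ∂(gibbsK F ℰp γ K) ≤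
      24 * E * (n : ℝ) ^ 3 := by
    rw [← integral_const_mul]
    exact hJ.trans hlog
  rw [hβeq] at hmean ⊢
  rw [le_div_iff₀ hβ0]
  nlinarith

end Region

/-! ## §2 The registered stub BY NAME AND SIGNATURE -/

open Classical in
/-- **stub_localBoxExpMoment (LINE 30 «CurvaturePoincare», stub (LM)), PROVED — token-identical with the registered stub of
`Cruxes/HistoryTailL/Lines/curvature_poincare.lean` (crux stmt-QuantumFields-23532).**  LOCAL exponential moment and mean of the box action at
coupling `β_K/24`: `∫ exp(β_K/24·Σ_{p∈box} dist₁²) dμ_K ≤ e^{E₁n³}` and `∫ Σ_{p∈box} dist₁² dμ_K ≤ E₁n³/β_K`, uniformly in `γ ≤ 1`, `K`, the volume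
and the box, plus the measurability and range rows.  Constants: `E₁ = 576·E` with `E` the absolute constant of the regional bare stiffness
(`exists_regional_expMoment_le`, hence of ✓`log_partitionFn_ratio_le_exact`), `γ₁ = 1`.  Proof: `localBox_rows_of_card_le` on the box region, whose
cardinality is `≤ 3(n+1)³` (✓`card_filter_mem_boxPlaqs_le`). [cite: FrohlichIsraelLiebSimon1978, Thm 4.1; Balaban1985UV3, (11) p.258] -/
theorem stub_localBoxExpMoment :
    ∀ (L : ℕ), ∃ (E₁ : ℝ), 0 ≤ E₁ ∧ ∃ γ₁ : ℝ, 0 < γ₁ ∧ γ₁ ≤ 1 ∧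
      ∀ (F : T3Family) (γ : ℝ), F.L = L → 0 < γ → γ ≤ γ₁ → ∀ (K n : ℕ) (x₀ : Site (F.P K) 0), 1 ≤ n → 2 * n ≤ (F.P K).sitesPerDir 0 →
        (Measurable fun U : GaugeField (F.P K) 0 (Matrix.specialUnitaryGroup (Fin 2) ℂ) => (∑ p ∈ Finset.univ.filter (fun p : Plaq (F.P K) 0 => p ∈ boxPlaqs (P := F.P K) (j := 0) (fun k => ((x₀ k).val : ℤ)) (fun k => ((x₀ k).val : ℤ) + ((n : ℤ) - 1))), GaugeGroup.dist1 (GaugeField.plaqHol U p) ^ 2)) ∧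
        (∀ U : GaugeField (F.P K) 0 (Matrix.specialUnitaryGroup (Fin 2) ℂ), 0 ≤ (∑ p ∈ Finset.univ.filter (fun p : Plaq (F.P K) 0 => p ∈ boxPlaqs (P := F.P K) (j := 0) (fun k => ((x₀ k).val : ℤ)) (fun k => ((x₀ k).val : ℤ) + ((n : ℤ) - 1))), GaugeGroup.dist1 (GaugeField.plaqHol U p) ^ 2) ∧ (∑ p ∈ Finset.univ.filter (fun p : Plaq (F.P K) 0 => p ∈ boxPlaqs (P := F.P K) (j := 0) (fun k => ((x₀ k).val : ℤ)) (fun k => ((x₀ k).val : ℤ) + ((n : ℤ) - 1))), GaugeGroup.dist1 (GaugeField.plaqHol U p) ^ 2) ≤ 12 * ((n : ℝ) + 1) ^ 3) ∧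
        ∫ U, Real.exp ((F.scheme ℰp γ).β K / 24 * (∑ p ∈ Finset.univ.filter (fun p : Plaq (F.P K) 0 => p ∈ boxPlaqs (P := F.P K) (j := 0) (fun k => ((x₀ k).val : ℤ)) (fun k => ((x₀ k).val : ℤ) + ((n : ℤ) - 1))), GaugeGroup.dist1 (GaugeField.plaqHol U p) ^ 2)) ∂(gibbsK F ℰp γ K) ≤ Real.exp (E₁ * (n : ℝ) ^ 3) ∧
        ∫ U, (∑ p ∈ Finset.univ.filter (fun p : Plaq (F.P K) 0 => p ∈ boxPlaqs (P := F.P K) (j := 0) (fun k => ((x₀ k).val : ℤ)) (fun k => ((x₀ k).val : ℤ) + ((n : ℤ) - 1))), GaugeGroup.dist1 (GaugeField.plaqHol U p) ^ 2) ∂(gibbsK F ℰp γ K) ≤ E₁ * (n : ℝ) ^ 3 / (F.scheme ℰp γ).β K := by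
  intro L
  obtain ⟨E, hE0, hE⟩ := exists_regional_expMoment_le
  refine ⟨576 * E, by positivity, 1, one_pos, le_rfl, fun F γ _hFL hγ hγ1 K n x₀ hn _h2n => ?_⟩
  have hbox : ∀ κ : Fin (F.P K).d, (fun k : Fin (F.P K).d => ((x₀ k).val : ℤ)) κ ≤ (fun k : Fin (F.P K).d => ((x₀ k).val : ℤ) + ((n : ℤ) - 1)) κ ∧
      (fun k : Fin (F.P K).d => ((x₀ k).val : ℤ) + ((n : ℤ) - 1)) κ ≤ (fun k : Fin (F.P K).d => ((x₀ k).val : ℤ)) κ + n := fun κ => by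
    have hn' : (1 : ℤ) ≤ n := by exact_mod_cast hn
    constructor <;> simp only <;> omega
  have hQ := card_filter_mem_boxPlaqs_le (F := F) (K := K) (fun k => ((x₀ k).val : ℤ)) (fun k => ((x₀ k).val : ℤ) + ((n : ℤ) - 1)) n hbox
  exact localBox_rows_of_card_le F hE0 hE hγ hγ1 K n hn _ hQ

end Summit.QuantumFields.YangMills.Theorems.CurvaturePoincareStubLocalBoxExpMoment

end
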